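import Mathlib
import HarnessLib

/-!
# A finite free algebra with enough rational points splits: `κ ⊗_A B ≅ κ^ι`

Topic: `Literature/RingTheory/Etale`.  Let `A → B` be a commutative algebra, FREE OF FINITE RANK `n` as an `A`-module, and
`κ` a field over `A`.  If `B` has `n` pairwise distinct `A`-algebra «points» `ψ i : B → κ` (`i ∈ ι`, `#ι = n`), then the
evaluation map
  `κ ⊗_A B ⟶ ∏_{i ∈ ι} κ`, `x ⊗ b ↦ (x · ψ i (b))_i`
is an isomorphism of `κ`-algebras: it is surjective by Dedekind's independence of characters (the `n` distinct `κ`-algebra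
homomorphisms `κ ⊗_A B → κ` are `κ`-linearly independent, so no non-zero linear form vanishes on the image), and both sides have
`κ`-dimension `n`.  Equivalently: a finite étale `κ`-algebra of degree `n` with `n` rational points is `κ^n`; the form proved
here needs no étaleness hypothesis — enough points force it.  Typical use (cell hodgecm-mathlib, E2 road P1): for a number
field `K` unramified at `p` and `L ⊇` all conjugates of `K`, `𝓞_K ⊗_ℤ κ(𝔓) ≅ ∏_{φ : K → L} κ(𝔓)` — the eigen-decomposition
along the embeddings, read modulo a prime `𝔓 ∣ p` of `L` (sibling file
`Literature/NumberTheory/NumberFields/RingOfIntegersResidueSplitting.lean`).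

Main statements (namespace `Literature.RingTheory.Etale`):
* `linearIndependent_algHom_toLinearMap` — distinct `κ`-algebra homomorphisms `C → κ` are linearly independent as linear maps;
* `surjective_pi_of_linearIndependent` — a family of linearly independent linear forms `C → κ` is jointly surjective onto `κ^ι`;
* `bijective_pi_baseChange_of_card_eq_finrank` — THE SPLITTING: for `B` free of rank `#ι` over `A` and pairwise distinct
  `ψ : ι → (B →ₐ[A] κ)`, the map `κ ⊗_A B → κ^ι` above is bijective.

References: N. Bourbaki, *Algèbre*, Ch. V §6 no. 3 (diagonalisable / étale algebras: `A ⊗ K ≅ K^n` iff `A` has `n` points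
in `K`), §10; J. S. Milne, *Fields and Galois Theory*, Thm. 5.14 (Dedekind independence) and Ch. 8 («étale algebras»,
`Hom(A, Ω)` has `[A:F]` elements iff `A ⊗ Ω ≅ Ω^n`).  Elementary given Mathlib; theorems only, no definitions.
-/

namespace Literature.RingTheory.Etale

universe u v w

open TensorProduct Module

section Independence

variable {κ C : Type*} [Field κ] [CommRing C] [Algebra κ C] {ι : Type*}

/-- **Dedekind independence for algebra points.**  Pairwise distinct `κ`-algebra homomorphisms `C → κ` are `κ`-linearly
independent as linear maps `C →ₗ[κ] κ` (restriction of Dedekind's independence of characters `C →* κ`,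
Mathlib `linearIndependent_monoidHom`). [cite: MilneFT2022, Thm. 5.14 (Dedekind)] -/
theorem linearIndependent_algHom_toLinearMap (ψ : ι → (C →ₐ[κ] κ)) (hψ : Function.Injective ψ) :
    LinearIndependent κ (fun i => (ψ i).toLinearMap) := by
  -- Dedekind: all monoid homomorphisms `C →* κ` are linearly independent as functions `C → κ`
  have hD := linearIndependent_monoidHom C κ
  -- our family, as functions, is a sub-family of that one along an injective index map
  have hinj : Function.Injective (fun i => (ψ i : C →* κ)) := by
    intro i j h
    apply hψ
    apply AlgHom.ext
    intro x
    exact DFunLike.congr_fun h x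
  have hF : LinearIndependent κ (fun i => ((ψ i : C →* κ) : C → κ)) := hD.comp _ hinj
  -- transport along the injective linear map `(C →ₗ[κ] κ) → (C → κ)`
  refine LinearIndependent.of_comp (LinearMap.ltoFun κ C κ κ) ?_
  convert hF using 1
  exact funext fun i => rfl

/-- **Linearly independent linear forms are jointly surjective.**  If `ℓ i : C →ₗ[κ] κ` (`i ∈ ι`, finite) are linearly
independent, then `c ↦ (ℓ i c)_i : C → κ^ι` is surjective: otherwise a non-zero linear form on `κ^ι` vanishes on the image,
i.e. a non-trivial combination `Σ aᵢ ℓᵢ` is zero. [cite: MilneFT2022, Thm. 5.14 and Cor. 5.15] -/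
theorem surjective_pi_of_linearIndependent [Fintype ι] (ℓ : ι → (C →ₗ[κ] κ)) (hℓ : LinearIndependent κ ℓ) :
    Function.Surjective (LinearMap.pi ℓ : C →ₗ[κ] (ι → κ)) := by
  classical
  by_contra hsurj
  have hlt : LinearMap.range (LinearMap.pi ℓ) < ⊤ :=
    lt_top_iff_ne_top.mpr fun h => hsurj (LinearMap.range_eq_top.mp h)
  obtain ⟨f, hf0, hle⟩ := Submodule.exists_le_ker_of_lt_top _ hlt
  -- `f = Σ aᵢ evᵢ` with `aᵢ = f (eᵢ)`
  set a : ι → κ := fun i => f (Pi.single i 1) with ha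
  have hf : ∀ v : ι → κ, f v = ∑ i, a i * v i := by
    intro v
    conv_lhs => rw [show v = ∑ i, Pi.single i (v i) from (Finset.univ_sum_single v).symm]
    rw [map_sum]
    refine Finset.sum_congr rfl fun i _ => ?_
    rw [show Pi.single i (v i) = v i • (Pi.single i (1 : κ) : ι → κ) by
      rw [← Pi.single_smul', smul_eq_mul, mul_one], map_smul, smul_eq_mul, mul_comm]
  -- the combination `Σ aᵢ ℓᵢ` vanishes
  have hcomb : ∑ i, a i • ℓ i = 0 := by
    apply LinearMap.ext
    intro c
    have hc : f (LinearMap.pi ℓ c) = 0 := by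
      have := hle (LinearMap.mem_range_self (LinearMap.pi ℓ) c)
      rwa [LinearMap.mem_ker] at this
    rw [hf] at hc
    simpa [LinearMap.sum_apply, LinearMap.smul_apply] using hc
  -- hence all `aᵢ = 0`, hence `f = 0`
  have ha0 : ∀ i, a i = 0 := fun i =>
    Fintype.linearIndependent_iff.mp hℓ a hcomb i
  apply hf0
  apply LinearMap.ext
  intro v
  rw [hf, LinearMap.zero_apply]
  exact Finset.sum_eq_zero fun i _ => by rw [ha0 i, zero_mul]

end Independence

section Splitting

variable {A : Type u} {B : Type v} {κ : Type w} [CommRing A] [CommRing B] [Algebra A B] [Field κ] [Algebra A κ]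
  {ι : Type*}

/-- The evaluation map `κ ⊗_A B → κ`, `x ⊗ b ↦ x · ψ(b)`, attached to an `A`-algebra point `ψ : B → κ`, on pure tensors.
[cite: MilneFT2022, Ch. 8 (étale algebras)] -/
theorem lift_id_tmul (ψ : B →ₐ[A] κ) (x : κ) (b : B) :
    Algebra.TensorProduct.lift (AlgHom.id κ κ) ψ (fun _ _ => Commute.all _ _) (x ⊗ₜ[A] b) = x * ψ b :=
  Algebra.TensorProduct.lift_tmul _ _ _ x b

/-- Distinct `A`-algebra points `B → κ` give distinct `κ`-algebra points `κ ⊗_A B → κ`. [cite: MilneFT2022, Ch. 8 (étale algebras)] -/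
theorem lift_id_injective :
    Function.Injective (fun ψ : B →ₐ[A] κ =>
      Algebra.TensorProduct.lift (AlgHom.id κ κ) ψ (fun _ _ => Commute.all _ _)) := by
  intro ψ₁ ψ₂ h
  apply AlgHom.ext
  intro b
  have := DFunLike.congr_fun h ((1 : κ) ⊗ₜ[A] b)
  simpa [Algebra.TensorProduct.lift_tmul] using this

/-- **A finite free algebra with enough rational points splits.**  Let `B` be free of finite rank over `A`, `κ` a field over
`A`, and `ψ : ι → (B →ₐ[A] κ)` pairwise distinct with `#ι = rank_A B`.  Then `κ ⊗_A B → κ^ι`, `x ⊗ b ↦ (x · ψ i b)_i`, is a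
BIJECTIVE `κ`-algebra homomorphism (surjective by Dedekind independence, dimensions agree by `finrank_baseChange`).
[cite: MilneFT2022, Ch. 8 (étale algebras: `A ⊗ Ω ≅ Ω^n` iff `#Hom(A,Ω) = [A:F]`)] -/
theorem bijective_pi_baseChange_of_card_eq_finrank [Fintype ι] [Module.Free A B] [Module.Finite A B]
    (ψ : ι → (B →ₐ[A] κ)) (hψ : Function.Injective ψ) (hcard : Fintype.card ι = Module.finrank A B) :
    Function.Bijective (AlgHom.pi (fun i =>
      Algebra.TensorProduct.lift (AlgHom.id κ κ) (ψ i) (fun _ _ => Commute.all _ _)) :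
        κ ⊗[A] B →ₐ[κ] (ι → κ)) := by
  classical
  haveI : Nontrivial A := (algebraMap A κ).domain_nontrivial
  set Ψ : ι → (κ ⊗[A] B →ₐ[κ] κ) := fun i =>
    Algebra.TensorProduct.lift (AlgHom.id κ κ) (ψ i) (fun _ _ => Commute.all _ _) with hΨ
  have hΨinj : Function.Injective Ψ := fun i j h => hψ (lift_id_injective h)
  -- surjectivity: the components are linearly independent linear forms
  have hli := linearIndependent_algHom_toLinearMap Ψ hΨinj
  have hsurj : Function.Surjective (LinearMap.pi fun i => (Ψ i).toLinearMap) :=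
    surjective_pi_of_linearIndependent _ hli
  have hsurj' : Function.Surjective (AlgHom.pi Ψ : κ ⊗[A] B →ₐ[κ] (ι → κ)) := by
    intro v
    obtain ⟨c, hc⟩ := hsurj v
    exact ⟨c, by ext i; exact congr_fun hc i⟩
  -- dimension count
  have hdim : Module.finrank κ (κ ⊗[A] B) = Module.finrank κ (ι → κ) := by
    rw [Module.finrank_baseChange, Module.finrank_fintype_fun_eq_card, hcard]
  have hinj : Function.Injective (AlgHom.pi Ψ : κ ⊗[A] B →ₐ[κ] (ι → κ)) :=
    (LinearMap.injective_iff_surjective_of_finrank_eq_finrank hdim (f := (AlgHom.pi Ψ).toLinearMap)).mpr hsurj'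
  exact ⟨hinj, hsurj'⟩

/-- Pointwise formula for the splitting map: component `i` of the image of `x ⊗ b` is `x · ψ i (b)`.
[cite: MilneFT2022, Ch. 8 (étale algebras)] -/
theorem pi_lift_id_tmul (ψ : ι → (B →ₐ[A] κ)) (x : κ) (b : B) (i : ι) :
    (AlgHom.pi (fun i => Algebra.TensorProduct.lift (AlgHom.id κ κ) (ψ i) (fun _ _ => Commute.all _ _)) :
      κ ⊗[A] B →ₐ[κ] (ι → κ)) (x ⊗ₜ[A] b) i = x * ψ i b := by
  rw [AlgHom.pi_apply, Algebra.TensorProduct.lift_tmul]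
  rfl

end Splitting

end Literature.RingTheory.Etale
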